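import Summits.HodgeConjecture.HodgeCM.PerL34.FockIrreducible_2

/-! PORT of `HodgeCM/PerL34/FockIrreducible.lean` (HodgeCMPerL run 82) — part 3: continuation of `Summits.HodgeConjecture.HodgeCM.PerL34.FockIrreducible_2` (split at a top-level declaration boundary by port_pkg.py; scope re-opened below; declarations unchanged). -/

-- port_pkg: scope re-opened for this part (file-level context, then the namespace/section stack open at the cut)
set_option autoImplicit false
namespace HodgeCM
namespace PerL34
namespace Fock
open MvPolynomial Finsupp
open scoped BigOperators
section Harmonic
/-- (Ported verbatim from the HodgeCMPerL package; no docstring in the source.) -/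
theorem hpiece_map_mem (k : ℤ) : ∀ o : GOp, ∀ f ∈ hpiece k, gop o f ∈ hpiece k := by
  intro o f hf
  refine map_mem_wpiece (gop o) uWt k (fun m hm => ?_) hf
  cases o with
  | E i j =>
    change hE i j _ ∈ _
    rw [hE_monomial]
    by_cases hj : m (Sum.inl j) = 0
    · rw [hj, Nat.cast_zero, zero_smul]
      exact Submodule.zero_mem _
    · refine Submodule.smul_mem _ _ (monomial_mem_wpiece ?_ _)
      rw [wt_add, wt_single, wt_tsub_single uWt hj, hm]
      simp only [uWt]
      ring
  | H =>
    change hH _ ∈ _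
    rw [hH_monomial]
    exact Submodule.smul_mem _ _ (monomial_mem_wpiece hm _)
  | P i =>
    change hP i _ ∈ _
    rw [hP_monomial]
    refine monomial_mem_wpiece ?_ _
    rw [wt_add, wt_add, wt_single, wt_single, hm]
    simp only [uWt]
    ring
  | Q i =>
    change hQ i _ ∈ _
    rw [hQ_monomial]
    by_cases h0 : m (Sum.inl i) * m (Sum.inr ()) = 0
    · rw [h0, Nat.cast_zero, zero_smul]
      exact Submodule.zero_mem _
    · obtain ⟨ha, hw'⟩ := mul_ne_zero_iff.mp h0
      refine Submodule.smul_mem _ _ (monomial_mem_wpiece ?_ _)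
      have h1 : (m - single (Sum.inr ()) 1 : HarmVar →₀ ℕ) (Sum.inl i) ≠ 0 := by
        rw [Finsupp.tsub_apply, single_apply, if_neg Sum.inr_ne_inl, tsub_zero]
        exact ha
      rw [wt_tsub_single uWt h1, wt_tsub_single uWt hw', hm]
      simp only [uWt]
      ring

/-- (Ported verbatim from the HodgeCMPerL package; no docstring in the source.) -/
theorem isGStable_hpiece (k : ℤ) : IsGStable (hpiece k) :=
  (isGStable_iff _).mpr (hpiece_map_mem k)

/-- (Ported verbatim from the HodgeCMPerL package; no docstring in the source.) -/
theorem hz_zero_mem_jplus : hz 0 ∈ hpiece 1 := by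
  rw [hz_zero_eq]
  simpa using hmon_mem_hpiece 1 0 0

/-! ### 3.5 Linking monomials of one weight inside a stable subspace -/

section Reach

variable (M : Submodule ℂ HarmModel)

/-- (Ported verbatim from the HodgeCMPerL package; no docstring in the source.) -/
theorem hmon_mem_of_smul_mem {c : ℂ} (hc : c ≠ 0) {a b e : ℕ} (h : c • hmon a b e ∈ M) :
    hmon a b e ∈ M := by
  have h1 := M.smul_mem c⁻¹ h
  rwa [smul_smul, inv_mul_cancel₀ hc, one_smul] at h1

/-- `E₁₂`-moves: collect the `z₂`'s into `z₁`'s. -/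
theorem reach_collect (hE01 : ∀ f ∈ M, hE 0 1 f ∈ M) :
    ∀ (b a e : ℕ), hmon a b e ∈ M → hmon (a + b) 0 e ∈ M := by
  intro b
  induction b with
  | zero => intro a e h; simpa using h
  | succ b ih =>
    intro a e h
    have h1 := hE01 _ h
    rw [hE01_hmon] at h1
    have h2 := hmon_mem_of_smul_mem M (Nat.cast_ne_zero.mpr (Nat.succ_ne_zero b)) h1
    have h3 := ih (a + 1) e h2
    rwa [show a + 1 + b = a + (b + 1) by omega] at h3

/-- `E₂₁`-moves: redistribute. -/
theorem reach_distribute (hE10 : ∀ f ∈ M, hE 1 0 f ∈ M) :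
    ∀ (b a e : ℕ), hmon (a + b) 0 e ∈ M → hmon a b e ∈ M := by
  intro b
  induction b with
  | zero => intro a e h; simpa using h
  | succ b ih =>
    intro a e h
    have h1 : hmon (a + 1) b e ∈ M := ih (a + 1) e (by rwa [show a + 1 + b = a + (b + 1) by omega])
    have h2 := hE10 _ h1
    rw [hE10_hmon] at h2
    exact hmon_mem_of_smul_mem M (Nat.cast_ne_zero.mpr (Nat.succ_ne_zero a)) h2

/-- `P₁`-moves: raise. -/
theorem reach_raise (hP0 : ∀ f ∈ M, hP 0 f ∈ M) :
    ∀ (j a b e : ℕ), hmon a b e ∈ M → hmon (a + j) b (e + j) ∈ M := by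
  intro j
  induction j with
  | zero => intro a b e h; simpa using h
  | succ j ih =>
    intro a b e h
    have h1 := hP0 _ (ih a b e h)
    rw [hP0_hmon] at h1
    simpa only [add_assoc] using h1

/-- `P₂`-moves: raise. -/
theorem reach_raise' (hP1 : ∀ f ∈ M, hP 1 f ∈ M) :
    ∀ (j a b e : ℕ), hmon a b e ∈ M → hmon a (b + j) (e + j) ∈ M := by
  intro j
  induction j with
  | zero => intro a b e h; simpa using h
  | succ j ih =>
    intro a b e h
    have h1 := hP1 _ (ih a b e h)
    rw [hP1_hmon] at h1
    simpa only [add_assoc] using h1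

/-- `Q₁`-moves: lower. -/
theorem reach_lower (hQ0 : ∀ f ∈ M, hQ 0 f ∈ M) :
    ∀ (j a b e : ℕ), hmon (a + j) b (e + j) ∈ M → hmon a b e ∈ M := by
  intro j
  induction j with
  | zero => intro a b e h; simpa using h
  | succ j ih =>
    intro a b e h
    have h0 : hmon (a + j + 1) b (e + j + 1) ∈ M := by simpa only [add_assoc] using h
    have h1 := hQ0 _ h0
    rw [hQ0_hmon] at h1
    exact ih a b e
      (hmon_mem_of_smul_mem M (Nat.cast_ne_zero.mpr (mul_ne_zero (Nat.succ_ne_zero _) (Nat.succ_ne_zero _))) h1)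

/-- All monomials of one `U(1)`-weight are linked inside a `𝔤′`-stable subspace. -/
theorem hmon_mem_of_hmon_mem (hM : IsGStable M) {a₀ b₀ e₀ : ℕ} (h₀ : hmon a₀ b₀ e₀ ∈ M) {a b e : ℕ}
    (hk : (a₀ : ℤ) + b₀ - e₀ = (a : ℤ) + b - e) : hmon a b e ∈ M := by
  have h1 : hmon (a₀ + b₀) 0 e₀ ∈ M := reach_collect M (hM.1.1 0 1) b₀ a₀ e₀ h₀
  have h2 : hmon (a + b) 0 e ∈ M := by
    by_cases hle : a₀ + b₀ ≤ a + b
    · obtain ⟨j, hj⟩ : ∃ j, a + b = a₀ + b₀ + j := ⟨a + b - (a₀ + b₀), by omega⟩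
      have he : e = e₀ + j := by omega
      rw [hj, he]
      exact reach_raise M (hM.2.1 0) j _ 0 _ h1
    · obtain ⟨j, hj⟩ : ∃ j, a₀ + b₀ = a + b + j := ⟨a₀ + b₀ - (a + b), by omega⟩
      have he : e₀ = e + j := by omega
      rw [hj, he] at h1
      exact reach_lower M (hM.2.2 0) j _ 0 _ h1
  exact reach_distribute M (hM.1.1 1 0) b a e h2

end Reach

/-! ### 3.6 Irreducibility of every `F_k` (Howe duality (1)) -/

/-- **Howe duality for `(U(1), U(2,1))`, Adams Thm 6.3 (1) / Kashiwara–Vergne: every `U(1)`-isotypic piece `F_k`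
(`k ∈ ℤ`) of `ℂ[z₁,z₂,w]` is `𝔤′`-IRREDUCIBLE** — invariant-subspace form: a `𝔤′`-stable subspace meeting `F_k`
non-trivially contains `F_k`. -/
theorem hpiece_le_of_isGStable (k : ℤ) (M : Submodule ℂ HarmModel) (hM : IsGStable M) {v : HarmModel}
    (hvM : v ∈ M) (hv : v ≠ 0) (hvk : v ∈ hpiece k) : hpiece k ≤ M := by
  obtain ⟨m₀, hm₀⟩ : v.support.Nonempty := by
    rw [Finset.nonempty_iff_ne_empty, Ne, MvPolynomial.support_eq_empty]
    exact hv
  have hm₀M : monomial m₀ (1 : ℂ) ∈ M := monomial_mem_of_eulerStable M hM.1.euler hvM hm₀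
  have hk₀ := (mem_hpiece_iff k v).mp hvk m₀ hm₀
  rw [← hexp_eta m₀] at hm₀M
  intro f hf
  refine mem_of_monomial_mem M fun m hm => ?_
  have hk := (mem_hpiece_iff k f).mp hf m hm
  rw [← hexp_eta m]
  exact hmon_mem_of_hmon_mem M hM hm₀M (by rw [hk₀, hk])

/-- Equivalently: `F_k ∩ M` is `0` or `F_k` for every `𝔤′`-stable `M`. -/
theorem hpiece_inf_eq_bot_or (k : ℤ) (M : Submodule ℂ HarmModel) (hM : IsGStable M) :
    hpiece k ⊓ M = ⊥ ∨ hpiece k ≤ M := by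
  by_cases h : hpiece k ⊓ M = ⊥
  · exact Or.inl h
  · right
    obtain ⟨v, hv, hv0⟩ := (Submodule.ne_bot_iff _).mp h
    exact hpiece_le_of_isGStable k M hM hv.2 hv0 hv.1

/-- Irreducibility in pv12's `IsGeneratedBy` form (`ArchBGen`): every non-zero vector of `F_k` generates `F_k`
under the nine operators. -/
theorem hpiece_isGeneratedBy (k : ℤ) {v : HarmModel} (hvk : v ∈ hpiece k) (hv : v ≠ 0) :
    IsGeneratedBy (fun o : GOp => (gop o).restrict (hpiece_map_mem k o)) (⟨v, hvk⟩ : ↥(hpiece k)) :=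
  isGeneratedBy_restrict (hpiece k) gop (hpiece_map_mem k) hvk fun S hvS hS =>
    hpiece_le_of_isGStable k S ((isGStable_iff S).mpr hS) hvS hv hvk

/-- **PerL v5 l. 475 "the harmonic `z₁` generating `J⁺`" / Prop. 4.3 ll. 646–648**: the `J⁺`-piece
`F_1 = {f ∣ InJplus f}` is generated by `z₁` under `𝔤′`. -/
theorem jplus_isGeneratedBy_z₁ :
    IsGeneratedBy (fun o : GOp => (gop o).restrict (hpiece_map_mem 1 o)) (⟨hz 0, hz_zero_mem_jplus⟩ : ↥(hpiece 1)) :=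
  hpiece_isGeneratedBy 1 hz_zero_mem_jplus (by rw [hz_zero_eq]; exact hmon_ne_zero 1 0 0)

/-! ### 3.7 The `𝔭′⁻`-harmonics (Howe duality (3), (5)) -/

/-- `𝔭′⁻`-harmonic polynomials: killed by `Q₁, Q₂` (Adams Thm/Def. 6.1: "`𝓗(K) = {P ∈ 𝓕 ∣ X·P = 0 ∀ X ∈ 𝔭′⁻}`"). -/
def IsHarm (f : HarmModel) : Prop := ∀ a, hQ a f = 0

/-- (Ported verbatim from the HodgeCMPerL package; no docstring in the source.) -/
theorem IsHarm.add {f g : HarmModel} (hf : IsHarm f) (hg : IsHarm g) : IsHarm (f + g) := fun a => by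
  rw [map_add, hf a, hg a, add_zero]

/-- (Ported verbatim from the HodgeCMPerL package; no docstring in the source.) -/
theorem IsHarm.smul (c : ℂ) {f : HarmModel} (hf : IsHarm f) : IsHarm (c • f) := fun a => by
  rw [map_smul, hf a, smul_zero]

/-- Harmonicity is read off the support: no monomial contains both `w` and some `z_a`. -/
theorem isHarm_iff_support (f : HarmModel) :
    IsHarm f ↔ ∀ m ∈ f.support, m (Sum.inr ()) = 0 ∨ (m (Sum.inl 0) = 0 ∧ m (Sum.inl 1) = 0) := by
  constructor
  · intro h m hm
    by_contra hcon
    push Not at hcon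
    obtain ⟨a, ha⟩ : ∃ a : Fin 2, m (Sum.inl a) ≠ 0 := by
      by_cases h0 : m (Sum.inl 0) = 0
      · exact ⟨1, hcon.2 h0⟩
      · exact ⟨0, h0⟩
    set n : HarmVar →₀ ℕ := m - single (Sum.inl a) 1 - single (Sum.inr ()) 1 with hn
    have hnm : n + single (Sum.inl a) 1 + single (Sum.inr ()) 1 = m := by
      have h1 : (m - single (Sum.inl a) 1 : HarmVar →₀ ℕ) (Sum.inr ()) ≠ 0 := by
        rw [Finsupp.tsub_apply, single_apply, if_neg Sum.inl_ne_inr, tsub_zero]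
        exact hcon.1
      rw [hn, tsub_add_eq_add_tsub (single_le_iff.mpr (Nat.one_le_iff_ne_zero.mpr h1)),
        tsub_add_cancel_of_le (single_le_iff.mpr (Nat.one_le_iff_ne_zero.mpr ha)),
        tsub_add_cancel_of_le (single_le_iff.mpr (Nat.one_le_iff_ne_zero.mpr hcon.1))]
    have h2 := congrArg (coeff n) (h a)
    rw [coeff_hQ, coeff_zero, hnm] at h2
    rcases mul_eq_zero.mp h2 with h3 | h3
    · rcases mul_eq_zero.mp h3 with h4 | h4
      · exact Nat.cast_ne_zero.mpr (Nat.succ_ne_zero _) h4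
      · exact Nat.cast_ne_zero.mpr (Nat.succ_ne_zero _) h4
    · exact (MvPolynomial.mem_support_iff.mp hm) h3
  · intro h a
    ext n
    rw [coeff_hQ, coeff_zero]
    have h0 : coeff (n + single (Sum.inl a) 1 + single (Sum.inr ()) 1) f = 0 := by
      by_contra hne
      have h1 := h _ (MvPolynomial.mem_support_iff.mpr hne)
      fin_cases a <;> simp at h1
    rw [h0, mul_zero]

/-- For an exponent of `U(1)`-weight `k`, "harmonic type" means total degree exactly `|k|` … -/
theorem harmType_iff_degree_eq (m : HarmVar →₀ ℕ) :
    (m (Sum.inr ()) = 0 ∨ (m (Sum.inl 0) = 0 ∧ m (Sum.inl 1) = 0)) ↔ m.degree = (wt uWt m).natAbs := by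
  rw [degree_harmVar, wt_uWt']
  omega

/-- … and `|k|` is the least total degree occurring in `F_k` (`= d(σ_k)`, Adams Def. 6.2). -/
theorem natAbs_wt_le_degree (m : HarmVar →₀ ℕ) : (wt uWt m).natAbs ≤ m.degree := by
  rw [degree_harmVar, wt_uWt']
  omega

/-- **Adams Thm 6.3 (3)**: inside `F_k` the harmonics are exactly the polynomials of the lowest degree `|k|`. -/
theorem isHarm_iff_lowestDegree {k : ℤ} {f : HarmModel} (hf : f ∈ hpiece k) :
    IsHarm f ↔ ∀ m ∈ f.support, m.degree = k.natAbs := by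
  rw [isHarm_iff_support]
  rw [mem_wpiece_iff_support] at hf
  refine forall₂_congr fun m hm => ?_
  rw [harmType_iff_degree_eq, hf m hm]

/-- (Ported verbatim from the HodgeCMPerL package; no docstring in the source.) -/
theorem natAbs_le_degree_of_mem_hpiece {k : ℤ} {f : HarmModel} (hf : f ∈ hpiece k) {m : HarmVar →₀ ℕ}
    (hm : m ∈ f.support) : k.natAbs ≤ m.degree := by
  rw [← (mem_wpiece_iff_support _ _ _).mp hf m hm]
  exact natAbs_wt_le_degree m

/-- (Ported verbatim from the HodgeCMPerL package; no docstring in the source.) -/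
theorem isHarm_hmon_zfree (a b : ℕ) : IsHarm (hmon a b 0) := fun i => by
  rw [hmon, hQ_monomial, hexp_inr, mul_zero, Nat.cast_zero, zero_smul]

/-- (Ported verbatim from the HodgeCMPerL package; no docstring in the source.) -/
theorem isHarm_hw_pow (e : ℕ) : IsHarm (hmon 0 0 e) := by
  rw [isHarm_iff_support]
  intro m hm
  rw [hmon, support_monomial, if_neg one_ne_zero, Finset.mem_singleton] at hm
  rw [hm, hexp_inl_zero, hexp_inl_one]
  exact Or.inr ⟨rfl, rfl⟩

/-- `k = n ≥ 0`: the harmonics of `F_n` are the `w`-free forms of degree `n` in `z₁, z₂` (`≅ Sym^n(V⁺) ⊗ vacuum`,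
dimension `n + 1`; Adams Prop. 6.6 / [Ich22] L7.10 for this pair). -/
theorem harm_nonneg_iff (n : ℕ) (f : HarmModel) :
    (f ∈ hpiece (n : ℤ) ∧ IsHarm f) ↔
      ∀ m ∈ f.support, m (Sum.inr ()) = 0 ∧ m (Sum.inl 0) + m (Sum.inl 1) = n := by
  rw [mem_hpiece_iff, isHarm_iff_support]
  constructor
  · rintro ⟨h1, h2⟩ m hm
    have h3 := h1 m hm
    have h4 := h2 m hm
    omega
  · intro h
    refine ⟨fun m hm => ?_, fun m hm => ?_⟩
    · have := h m hm; omega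
    · have := h m hm; omega

/-- `k = -(n+1) < 0`: the harmonics of `F_{-(n+1)}` form the line `ℂ·w^{n+1}` (`≅ vacuum ⊗ (V⁻)^{⊗(n+1)}`). -/
theorem harm_neg_iff (n : ℕ) (f : HarmModel) :
    (f ∈ hpiece (-((n + 1 : ℕ) : ℤ)) ∧ IsHarm f) ↔ ∃ c : ℂ, f = c • hw ^ (n + 1) := by
  constructor
  · rintro ⟨h1, h2⟩
    rw [mem_hpiece_iff] at h1
    rw [isHarm_iff_support] at h2
    refine ⟨coeff (hexp 0 0 (n + 1)) f, ?_⟩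
    rw [hw_pow_eq, hmon, smul_monomial, smul_eq_mul, mul_one]
    apply eq_monomial_of_support
    intro m hm
    have h3 := h1 m hm
    have h4 := h2 m hm
    exact eq_hexp_iff.mpr (by omega)
  · rintro ⟨c, rfl⟩
    rw [hw_pow_eq]
    refine ⟨Submodule.smul_mem _ _ ?_, (isHarm_hw_pow (n + 1)).smul c⟩
    have := hmon_mem_hpiece 0 0 (n + 1)
    simpa using this

/-- `k = 0`: the harmonics of `F_0` are the constants (the vacuum line). -/
theorem harm_zero_iff (f : HarmModel) : (f ∈ hpiece 0 ∧ IsHarm f) ↔ ∃ c : ℂ, f = C c := by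
  have h0 := harm_nonneg_iff 0 f
  rw [Nat.cast_zero] at h0
  rw [h0]
  constructor
  · intro h
    refine ⟨coeff 0 f, eq_C_of_support_subset_zero fun m hm => ?_⟩
    have := h m hm
    ext v
    rcases v with c | u
    · fin_cases c <;> simp <;> omega
    · simpa using this.1
  · rintro ⟨c, rfl⟩ m hm
    rw [support_C] at hm
    split_ifs at hm with hc
    · simp at hm
    · rw [Finset.mem_singleton] at hm
      simp [hm]

/-- `k = 1` (PerL's `J⁺`): the harmonics of `F_1` form the plane `ℂ z₁ ⊕ ℂ z₂` (`≅ V⁺ = 𝔭₊` twisted by the vacuum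
character: the lowest `K′`-type of `J⁺`, cf. pv12 `jplus_lowest` for its highest weight line `ℂ z₁`). -/
theorem harm_one_iff (f : HarmModel) :
    (f ∈ hpiece 1 ∧ IsHarm f) ↔ ∃ c₀ c₁ : ℂ, f = c₀ • hz 0 + c₁ • hz 1 := by
  have h0 := harm_nonneg_iff 1 f
  rw [Nat.cast_one] at h0
  rw [h0]
  constructor
  · intro h
    refine ⟨coeff (hexp 1 0 0) f, coeff (hexp 0 1 0) f, ?_⟩
    rw [hz_zero_eq, hz_one_eq, hmon, hmon]
    ext m
    rw [coeff_add, coeff_smul, coeff_smul, coeff_monomial, coeff_monomial, smul_eq_mul, smul_eq_mul]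
    by_cases h1 : hexp 1 0 0 = m
    · have h2 : ¬ hexp 0 1 0 = m := by
        rw [← h1]; intro h3; have := congrArg (fun v => v (Sum.inl 0)) h3; simp at this
      rw [if_pos h1, if_neg h2, ← h1]; ring
    · by_cases h2 : hexp 0 1 0 = m
      · rw [if_neg h1, if_pos h2, ← h2]; ring
      · rw [if_neg h1, if_neg h2, mul_zero, mul_zero, add_zero]
        by_contra hne
        have h3 := h m (MvPolynomial.mem_support_iff.mpr hne)
        rcases Nat.eq_zero_or_pos (m (Sum.inl 0)) with h4 | h4
        · exact h2 (eq_hexp_iff.mpr ⟨by omega, by omega, by omega⟩).symm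
        · exact h1 (eq_hexp_iff.mpr ⟨by omega, by omega, by omega⟩).symm
  · rintro ⟨c₀, c₁, rfl⟩
    rw [← h0]
    refine ⟨Submodule.add_mem _ (Submodule.smul_mem _ _ hz_zero_mem_jplus) (Submodule.smul_mem _ _ ?_), ?_⟩
    · rw [hz_one_eq]; simpa using hmon_mem_hpiece 0 1 0
    · rw [hz_zero_eq, hz_one_eq]
      exact ((isHarm_hmon_zfree 1 0).smul c₀).add ((isHarm_hmon_zfree 0 1).smul c₁)


-- port_pkg: scope closed for this part
end Harmonic
end Fock
end PerL34
end HodgeCM
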